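import Summits.CriticalPhenomena.PercolationContinuityZ3.Theorems.Transplant.BoxProdZ2TubeLevels
import HarnessLib

/-!
# Restricting a weighting of `X □ ℤ²` to the pairs of a fibre window: a subbox weighting of `X □ ℤ²` that charges only edges becomes a subbox
# weighting of the TUBE graph over `π` (the transfer p2-g2's `hreach_of_chain'` needs to run the corridor chain in `tubeGraph X π`;
# BLUEPRINT-I-PHI §1 "cell window")

builds on p205010 (kernel theorem, internal audit signed; external expert review pending) — nothing in this file uses p205010.
Lane `prim-bschramm`, seat `prim-bschramm-p3`; helper file (`--supports stmt-CriticalPhenomena-4575 --as helper`).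

* `tubeRestrict π W` — the weighting `W` on the pairs with both fibre coordinates in `π`, `0` elsewhere; `tubeRestrict_le` (pointwise `≤ W`);
* **`isSubbox_tubeRestrict`** — if `W` is a subbox weighting of `X □ ℤ²` on `D ⊆ π × ℤ²` (`KNLevels.IsSubbox`) and charges only edges of
  `X □ ℤ²` (`EdgeSupp`), then `tubeRestrict π W` is a subbox weighting of `tubeGraph X π` on `D` — the hypothesis `hsub` of `lhyp_tube`;
* `finSupp_tubeRestrict` — finite support is inherited.

[cite: KozmaNitzan2024, §4 p. 17 (subbox) — the ℤ^d model]
-/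

noncomputable section

open scoped Classical

namespace Summit.CriticalPhenomena.PercolationContinuityZ3.Theorems

namespace Transplant

namespace BoxProdZ2

open Literature.Probability.Percolation Literature.Probability.LatticeModels SimpleGraph KNLevels

variable {W : Type} [DecidableEq W] (X : SimpleGraph W) [X.LocallyFinite]

omit [X.LocallyFinite] in
/-- **The restriction of a weighting to the pairs of the window `π × ℤ²`.** [folklore] -/
def tubeRestrict (π : Finset W) (Wt : Sym2 (W × Site 2) → unitInterval) : Sym2 (W × Site 2) → unitInterval :=
  fun e => if ∀ z ∈ e, z.1 ∈ π then Wt e else 0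

omit [X.LocallyFinite] in
/-- The restricted weighting on a pair, unfolded. [folklore] -/
theorem tubeRestrict_mk (π : Finset W) (Wt : Sym2 (W × Site 2) → unitInterval) (x y : W × Site 2) :
    tubeRestrict π Wt s(x, y) = if x.1 ∈ π ∧ y.1 ∈ π then Wt s(x, y) else 0 := by
  unfold tubeRestrict
  by_cases h : x.1 ∈ π ∧ y.1 ∈ π
  · rw [if_pos h, if_pos]; intro z hz; rcases Sym2.mem_iff.1 hz with rfl | rfl; exacts [h.1, h.2]
  · rw [if_neg h, if_neg]; intro h'; exact h ⟨h' x (Sym2.mem_mk_left x y), h' y (Sym2.mem_mk_right x y)⟩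

omit [DecidableEq W] [X.LocallyFinite] in
/-- The restriction is pointwise below the weighting. [folklore] -/
theorem tubeRestrict_le (π : Finset W) (Wt : Sym2 (W × Site 2) → unitInterval) (e : Sym2 (W × Site 2)) : tubeRestrict π Wt e ≤ Wt e := by
  unfold tubeRestrict; split_ifs
  · exact le_rfl
  · exact bot_le

omit [DecidableEq W] [X.LocallyFinite] in
/-- **Edge-supported weighting**: only edges of `X □ ℤ²` carry weight (true for every weighting built from `lattW` by restriction, pinning
on edges and wiring of edges). [folklore] -/
def EdgeSupp (Wt : Sym2 (W × Site 2) → unitInterval) : Prop := ∀ e, Wt e ≠ 0 → e ∈ (X □ zdGraph 2).edgeSet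

/-- **Subbox weightings of `X □ ℤ²` restrict to subbox weightings of the tube graph** on regions inside the window.
[cite: KozmaNitzan2024, §4 p. 17 (subbox)] -/
theorem isSubbox_tubeRestrict {π : Finset W} {Wt : Sym2 (W × Site 2) → unitInterval} {p : unitInterval} {D : Finset (W × Site 2)}
    (h : IsSubbox (X □ zdGraph 2) Wt p D) (hE : EdgeSupp X Wt) (hDπ : ∀ v ∈ D, v.1 ∈ π) :
    IsSubbox (tubeGraph X π) (tubeRestrict π Wt) p D where
  adj u hu v hv huv := by
    rw [tubeRestrict_mk, if_pos ⟨hDπ u hu, hDπ v hv⟩]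
    exact h.adj u hu v hv ((tubeGraph_adj X).1 huv).1
  nadj u hu v hv hne huv := by
    rw [tubeRestrict_mk, if_pos ⟨hDπ u hu, hDπ v hv⟩]
    exact h.nadj u hu v hv hne fun h' => huv ((tubeGraph_adj X).2 ⟨h', hDπ u hu, hDπ v hv⟩)
  outside v hv hvb x hx := by
    rw [tubeRestrict_mk]
    split_ifs with hπ
    · -- `x` has its fibre in `π`: if `s(x, v)` were an edge, `x` would be a tube-neighbour of the interior vertex `v`, hence in `D`
      by_contra hne
      have hedge := hE _ hne
      rw [SimpleGraph.mem_edgeSet] at hedge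
      apply hvb
      rw [mem_innerBoundary_iff]
      exact ⟨hv, x, hx, (tubeGraph_adj X).2 ⟨hedge.symm, hπ.2, hπ.1⟩⟩
    · rfl

omit [DecidableEq W] [X.LocallyFinite] in
/-- Finite support is inherited by the restriction. [folklore] -/
theorem finSupp_tubeRestrict {π : Finset W} {Wt : Sym2 (W × Site 2) → unitInterval} {Sfin : Finset (W × Site 2)} (h : FinSupp Wt Sfin) :
    FinSupp (tubeRestrict π Wt) Sfin := by
  refine ⟨fun e he => ?_⟩
  have := h.zero e he
  unfold tubeRestrict; split_ifs
  · exact this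
  · rfl

end BoxProdZ2

end Transplant

end Summit.CriticalPhenomena.PercolationContinuityZ3.Theorems

end
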